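import Mathlib
import Literature.NumberTheory.Irrationality.Lai2025TwoAdic.GeneralRationalFunctionB
import HarnessLib

/-!
# Lai 2025 (IJNT, `2`-adic zeta values), §3–§5 for GENERAL `s`, the `A`-family: the rational function
# `A_n(t) = 2^{(6s+12)n}(4t+2n)^δ(t+¼)_n^{s+2}(t+¾)_n^{s+2}/(t)_{n+1}^{2s+4}`, its partial fractions (def_a),
# Lemma 4.2 (the `d_n`-part) and the coefficient estimate of Lemma 5.2 — PROVED

Topic `Literature/NumberTheory/Irrationality/Lai2025TwoAdic`.  Source: L. Lai, *On the irrationality of certain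
`2`-adic zeta values*, Int. J. Number Theory (2025) = arXiv:2304.00816 [Lai2025TwoAdicZeta] (held text
`paper:arxiv-2304.00816`, chunks p0007–p0010 = §3 "Rational functions and linear forms", §4 "Arithmetic
properties", §5 "Archimedean properties", read on the page).  PROOF FILE (definitions with bodies + theorems; no
named fact, net debt 0): first file of the groundwork for the tree's named fact `PAdicZetaValues.lai2025TwoAdic_theorem12`
([Lai2025TwoAdicZeta, Thm 1.2]: one of `ζ₂(j,¼)`, `j ∈ [s+3, 3s+5]`, `j ≡ δ (mod 2)`, is irrational), the `A`-twin of the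
sibling `GeneralRationalFunctionB.lean` (whose bricks `quarterBrick`, `Pk`, `Greg` and Taylor-coefficient bookkeeping
`TaylorBound` are reused).  NOT formalised here (needed later for Thm 1.2): the `Φ_n`-refinement of Lemma 4.2
(Lemmas 4.3–4.4), Lemma 3.3 for `S_n` and §§5–7 for `S_n`.

## Source, as printed ([Lai2025TwoAdicZeta, §3–§5])

* **Definition 3.1.** «Fix a nonnegative integer `s` and fix a choice of `δ ∈ {0,1}`. For every positive integer `n` we
  define … `A_n(t) := 2^{(6s+12)n} · (4t+2n)^δ · (t+¼)_n^{s+2}(t+¾)_n^{s+2}/(t)_{n+1}^{2s+4}` … Both `A_n(t)` and `B_n(t)`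
  have degree `≤ −2`.  We define their partial fraction decompositions by `A_n(t) =: Σ_{i=1}^{2s+4}Σ_{k=0}^{n} a_{n,i,k}/(t+k)^i`
  (def_a).»
* **Lemma 4.1.** «`d_n^{s+2−i}·(1/(s+2−i)!)·(F(t)^{s+2})^{(s+2−i)}|_{t=−k} ∈ ℤ` for `F ∈ {F_{1/4}, F_{3/4}, (t+k)G}`»
  (`F_{a/4} = 2^{3n}(t+a/4)_n/n!`, `G = n!/(t)_{n+1}`; tree `quarterBrick_isDInt`, `Greg_isDInt`).
* **Lemma 4.2** (`d_n`-part, (ari_a)): «`d_n^{2s+4−i} a_{n,i,k} ∈ ℤ`» — `a_{n,i,k}` is the Taylor coefficient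
  `(1/(2s+4−i)!)((t+k)^{2s+4}A_n(t))^{(2s+4−i)}|_{t=−k}` of a product of bricks (the printed (strong_ari_a) with the
  extra factor `Φ_n^{−(s+2)}` is Lemmas 4.3–4.4, not here).
* **Lemma 5.2 (proof).** «It suffices to show `max_{i,k}|a_{n,i,k}| ≤ 2^{(6s+12+o(1))n}`» (Cauchy on `|t+k| = ⅛`).

## What is formalised (all PROVED)

* `As s δ n` (Definition 3.1, any `δ : ℕ`; the source has `δ ∈ {0,1}`), the brick form `AsReg s δ n k = Q_k^{s+2}(4t+2n)^δ`
  with `Qk n k = F_{1/4}·P_k·((t+k)G)` (`= 2^{6n}(t+¼)_n(t+¾)_n(t+k)²/(t)_{n+1}²`), `AsReg_eq`, `AsReg_isDInt`.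
* `coeffAs s δ n i k := 𝒟_{2s+4−i}(AsReg)(−k)` and **Lemma 4.2 (d_n-part)** `exists_int_lcm_pow_mul_coeffAs`.
* **(def_a)** `As_eq_sum_coeffAs` (`δ ≤ 1`): `A_n(t) = Σ_{k≤n}Σ_{i=1}^{2s+4} a_{n,i,k}(t+k)^{−i}` off the poles (existence via
  the tree's `exists_pfEval_eq_eval_mul_prod_inv`, identification via `divDeriv_eq_coeff_of_pfEval`).
* **Lemma 5.2 (coefficients), explicit form:** `abs_coeffAs_le` —
  `|a_{n,i,k}| ≤ 2^{(6s+12)n}·(4n+4)^δ·(10(s+2)n + δ)^{2s+4−i}` (DEVIATION, flagged: elementary Taylor-coefficient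
  bookkeeping `TaylorBound` instead of Cauchy's estimate; same exponential rate `2^{(6s+12)n}`).
* **The symmetry** `As_reflect` (`A_n(−t−n) = (−1)^δ A_n(t)`), `coeffAs_reflect` (`a_{n,i,k} = (−1)^{i+δ}a_{n,i,n−k}`),
  `sum_coeffAs_eq_zero_of_odd` («`ρ_{n,i} = 0` when `i ≢ δ (mod 2)`»), and `sum_coeffAs_one_eq_zero` («`ρ_{n,1} = 0`»,
  deg `A_n ≤ −2`, for `δ ≤ 1`).

Cell zeta5-irr / pub-zeta5 (HONEST FRAMING: systematic search; no irrationality claim unless kernel-certified):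
auxiliary `2`-adic material; nothing here bears on `ζ(5) ∈ ℝ`.
-/

noncomputable section

open Finset Filter Polynomial Literature.Analysis.Calculus
open Literature.NumberTheory.Transcendental
open Literature.NumberTheory.Irrationality.RivoalZudilin2020 (Greg Greg_eq Greg_isDInt)
open Literature.NumberTheory.Irrationality.LaiSprangZudilin2026 (divDeriv_eq_coeff_of_pfEval)
open Literature.NumberTheory.Irrationality.LaiSprangZudilin2026.Lemma53 (Greg_neg)
open scoped Nat Topology

namespace Literature.NumberTheory.Irrationality.Lai2025TwoAdic

/-! ## §1. Definition 3.1 for general `s`: `A_n(t)` and its brick form `Q_k(t)^{s+2}(4t+2n)^δ` -/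

/-- **Definition 3.1** (general `s`, parameter `δ`):
`A_n(t) := 2^{(6s+12)n} · (4t+2n)^δ · (t+¼)_n^{s+2}(t+¾)_n^{s+2} / (t)_{n+1}^{2s+4}` (degree `≤ −2` for `δ ≤ 1`).
[cite: Lai2025TwoAdicZeta, Definition 3.1 (A_n(t))] -/
def As (s δ n : ℕ) (t : ℚ) : ℚ :=
  (2 : ℚ) ^ ((6 * s + 12) * n) * (4 * t + 2 * n) ^ δ *
    ((∏ j ∈ range n, (t + 1 / 4 + j)) ^ (s + 2) * (∏ j ∈ range n, (t + 3 / 4 + j)) ^ (s + 2)) /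
    (∏ j ∈ range (n + 1), (t + j)) ^ (2 * s + 4)

/-- The brick `Q_k := F_{1/4} · P_k · ((t+k)G)` (`= F_{1/4}F_{3/4}((t+k)G)²`; tree `quarterBrick 1 n · Pk n k · Greg n k`).
[cite: Lai2025TwoAdicZeta, Lemma 4.2 (proof: "(t+k)^{2s+4}A_n(t) = F_{1/4}^{s+2}F_{3/4}^{s+2}((t+k)G)^{2s+4}(4t+2n)^δ")] -/
def Qk (n k : ℕ) (t : ℚ) : ℚ := quarterBrick 1 n t * Pk n k t * Greg n k t

/-- The BRICK FORM of `(t+k)^{2s+4}A_n(t)`, regular at `t = −k`: `Q_k(t)^{s+2}·(4t+2n)^δ`.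
[cite: Lai2025TwoAdicZeta, Lemma 4.2 (proof)] -/
def AsReg (s δ n k : ℕ) (t : ℚ) : ℚ := Qk n k t ^ (s + 2) * (4 * t + 2 * n) ^ δ

/-- `Q_k(t) = 2^{6n}(∏_{j<n}(t+¼+j))(∏_{j<n}(t+¾+j))(t+k)²/(∏_{l≤n}(t+l))²` off the poles and off `−k`.
[cite: Lai2025TwoAdicZeta, Lemma 4.2 (proof: F_{1/4}, F_{3/4}, G)] -/
theorem Qk_eq (n k : ℕ) {t : ℚ} (ht : ∀ j ∈ range (n + 1), t + j ≠ 0) (htk : t + k ≠ 0) :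
    Qk n k t = (2 : ℚ) ^ (6 * n) * (∏ j ∈ range n, (t + 1 / 4 + j)) * (∏ j ∈ range n, (t + 3 / 4 + j)) *
      (t + k) ^ 2 / (∏ j ∈ range (n + 1), (t + j)) ^ 2 := by
  have hprod : ∏ j ∈ range (n + 1), (t + j) ≠ 0 := prod_ne_zero_iff.2 ht
  have hfac : (n ! : ℚ) ≠ 0 := by exact_mod_cast Nat.factorial_ne_zero n
  unfold Qk
  rw [Pk_eq n k ht htk, quarterBrick, Greg_eq_mul_prod_inv n k htk, prod_inv_distrib]
  have e : ∏ j ∈ range n, (t + (((1 : ℤ) : ℚ) / 4 + j)) = ∏ j ∈ range n, (t + 1 / 4 + j) :=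
    prod_congr rfl fun j _ => by push_cast; ring
  rw [e, show (2 : ℚ) ^ (6 * n) = 2 ^ (3 * n) * 2 ^ (3 * n) by rw [← pow_add]; ring_nf]
  field_simp

/-- Off the poles `0, −1, …, −n` and off `−k`: `AsReg s δ n k t = A_n(t)·(t+k)^{2s+4}`.
[cite: Lai2025TwoAdicZeta, Lemma 4.2 (proof)] -/
theorem AsReg_eq (s δ n k : ℕ) {t : ℚ} (ht : ∀ j ∈ range (n + 1), t + j ≠ 0) (htk : t + k ≠ 0) :
    AsReg s δ n k t = As s δ n t * (t + k) ^ (2 * s + 4) := by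
  have hprod : ∏ j ∈ range (n + 1), (t + j) ≠ 0 := prod_ne_zero_iff.2 ht
  rw [AsReg, Qk_eq n k ht htk, As, div_pow, mul_pow, mul_pow, mul_pow, ← pow_mul, ← pow_mul, ← pow_mul,
    show 6 * n * (s + 2) = (6 * s + 12) * n by ring, show 2 * (s + 2) = 2 * s + 4 by ring]
  field_simp

/-- `AsReg s δ n k` is smooth at every `x` off the poles other than `−k`. [cite: Lai2025TwoAdicZeta, Lemma 4.2 (proof)] -/
theorem contDiffAt_AsReg (s δ n k : ℕ) {x : ℚ} (hx : ∀ l ∈ range (n + 1), l ≠ k → x + l ≠ 0)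
    {N : WithTop ℕ∞} : ContDiffAt ℚ N (AsReg s δ n k) x := by
  unfold AsReg Qk Pk
  have hG := contDiffAt_Greg n k hx (N := N)
  exact ((((contDiffAt_quarterBrick 1 n x).mul ((contDiffAt_quarterBrick 3 n x).mul hG)).mul hG).pow _).mul
    (by fun_prop)

/-- `−k` is off the other poles. [folklore] -/
private theorem neg_add_ne_zero_of_ne'' {k l : ℕ} (h : l ≠ k) : (-(k : ℚ)) + l ≠ 0 := by
  rw [show (-(k : ℚ) + l) = ((l : ℤ) - (k : ℤ) : ℤ) by push_cast; ring]
  exact_mod_cast sub_ne_zero.2 (by exact_mod_cast h : (l : ℤ) ≠ k)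

/-- `AsReg s δ n k` is smooth at `−k`. [cite: Lai2025TwoAdicZeta, Lemma 4.2 (proof)] -/
theorem contDiffAt_AsReg_neg (s δ n k : ℕ) {N : WithTop ℕ∞} : ContDiffAt ℚ N (AsReg s δ n k) (-(k : ℚ)) :=
  contDiffAt_AsReg s δ n k fun _ _ hl => neg_add_ne_zero_of_ne'' hl

/-- **`d_n^j · 𝒟_j((t+k)^{2s+4}A_n(t))(−k) ∈ ℤ`** for all `j` (`k ≤ n`): Leibniz over the bricks `F_{1/4}`, `F_{3/4}`
(Lemma 4.1, tree `quarterBrick_isDInt`), `(t+k)G(t)` (tree `Greg_isDInt`) and the integer polynomial `4t+2n`.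
[cite: Lai2025TwoAdicZeta, Lemma 4.2 (proof, (ari_a))] -/
theorem AsReg_isDInt (s δ n : ℕ) {k : ℕ} (hk : k ≤ n) (N : ℕ) :
    IsDInt (Nat.lcmUpto n) N (AsReg s δ n k) (-(k : ℚ)) := by
  have hF1 : IsDInt (Nat.lcmUpto n) N (quarterBrick 1 n) (-(k : ℚ)) := by
    simpa using quarterBrick_isDInt 1 n (-(k : ℤ)) N
  have hF3 : IsDInt (Nat.lcmUpto n) N (quarterBrick 3 n) (-(k : ℚ)) := by
    simpa using quarterBrick_isDInt 3 n (-(k : ℤ)) N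
  have hG := Greg_isDInt n hk N
  have hQ : IsDInt (Nat.lcmUpto n) N (Qk n k) (-(k : ℚ)) := (hF1.mul (hF3.mul hG)).mul hG
  have hL : IsDInt (Nat.lcmUpto n) N (fun t : ℚ => 4 * t + 2 * n) (-(k : ℚ)) := by
    have h := IsDInt.linear (Nat.lcmUpto n) N 4 (2 * n) (-(k : ℤ))
    push_cast at h
    exact h
  exact (hQ.pow (s + 2)).mul (hL.pow δ)

/-! ## §2. The coefficients `a_{n,i,k}` of (def_a) and Lemma 4.2 (the `d_n`-part), general `s` -/

/-- The coefficient `a_{n,i,k}` of (def_a), DEFINED as the Taylor coefficient `𝒟_{2s+4−i}((t+k)^{2s+4}A_n(t))|_{t=−k}`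
of the brick form. [cite: Lai2025TwoAdicZeta, Definition 3.1 (def_a) and Lemma 4.2 (proof)] -/
def coeffAs (s δ n i k : ℕ) : ℚ := divDeriv (2 * s + 4 - i) (AsReg s δ n k) (-(k : ℚ))

/-- **Lemma 4.2, (ari_a) without `Φ_n`, general `s`:** `d_n^{2s+4−i}·a_{n,i,k} ∈ ℤ` (`k ≤ n`, any `i`).
[cite: Lai2025TwoAdicZeta, Lemma 4.2 (ari_a)] -/
theorem exists_int_lcm_pow_mul_coeffAs (s δ n : ℕ) {k : ℕ} (hk : k ≤ n) (i : ℕ) :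
    ∃ z : ℤ, (Nat.lcmUpto n : ℚ) ^ (2 * s + 4 - i) * coeffAs s δ n i k = z :=
  (AsReg_isDInt s δ n hk (2 * s + 4 - i)).isInt (2 * s + 4 - i) le_rfl

/-- In particular `a_{n,2s+4,k} ∈ ℤ` (`k ≤ n`). [cite: Lai2025TwoAdicZeta, Lemma 4.2 (i = 2s+4)] -/
theorem exists_int_coeffAs_top (s δ n : ℕ) {k : ℕ} (hk : k ≤ n) : ∃ z : ℤ, coeffAs s δ n (2 * s + 4) k = z := by
  simpa using exists_int_lcm_pow_mul_coeffAs s δ n hk (2 * s + 4)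

/-! ### Existence of the expansion (def_a) (`δ ≤ 1`) and identification of its coefficients -/

/-- `|powShifts n c| = c(n+1)` (re-proved: the sibling's copy is private). [folklore] -/
private theorem length_powShifts' (n c : ℕ) : (powShifts n c).length = c * (n + 1) := by
  induction c with
  | zero => simp [powShifts]
  | succ c ih =>
    simp only [powShifts, List.length_append, Finset.length_toList, card_range, ih]
    ring

/-- Every shift is `≤ n`. [folklore] -/
private theorem mem_range_of_mem_powShifts' {n c i : ℕ} (hi : i ∈ powShifts n c) : i ∈ range (n + 1) := by
  induction c with
  | zero => simp [powShifts] at hi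
  | succ c ih =>
    simp only [powShifts, List.mem_append, Finset.mem_toList] at hi
    exact hi.elim id ih

/-- Every shift occurs at most `c` times. [folklore] -/
private theorem count_powShifts_le' (n c i : ℕ) : (powShifts n c).count i ≤ c := by
  induction c with
  | zero => simp [powShifts]
  | succ c ih =>
    have h1 : (range (n + 1)).toList.count i ≤ 1 :=
      List.nodup_iff_count_le_one.1 (Finset.nodup_toList _) i
    simp only [powShifts, List.count_append]
    omega

/-- `∏_{i ∈ powShifts n c} (t+i)⁻¹ = (∏_{j ≤ n} (t+j))^{−c}`. [folklore] -/
private theorem prod_powShifts' (n c : ℕ) (t : ℚ) :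
    ((powShifts n c).map fun i : ℕ => (t + (i : ℚ))⁻¹).prod = ((∏ j ∈ range (n + 1), (t + j)) ^ c)⁻¹ := by
  induction c with
  | zero => simp [powShifts]
  | succ c ih =>
    have h1 : (((range (n + 1)).toList).map fun i : ℕ => (t + (i : ℚ))⁻¹).prod
        = (∏ j ∈ range (n + 1), (t + j))⁻¹ := by
      rw [Finset.prod_map_toList, prod_inv_distrib]
    simp only [powShifts, List.map_append, List.prod_append, h1, ih, pow_succ]
    rw [mul_inv, mul_comm]

/-- A bound on the degree of `∏_{j<n}(X + u_j)`. [folklore] -/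
private theorem natDegree_prod_X_add_C_le'' (n : ℕ) (u : ℕ → ℚ) :
    (∏ j ∈ range n, (X + C (u j) : ℚ[X])).natDegree ≤ n := by
  refine (natDegree_prod_le _ _).trans ?_
  refine (sum_le_sum (g := fun _ => 1) fun j _ => (natDegree_X_add_C _).le).trans ?_
  simp

/-- EXISTENCE of an expansion of `A_n` with poles of order `≤ 2s+4` at `0, −1, …, −n` and no polynomial part
(`δ ≤ 1`): the numerator has degree `(2s+4)n + δ < (2s+4)(n+1)` («`A_n(t)` has degree `≤ −2`»).
[cite: Lai2025TwoAdicZeta, Definition 3.1 (def_a: the partial fractions of A_n)] -/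
theorem exists_As_eq_pfEval (s : ℕ) {δ : ℕ} (hδ : δ ≤ 1) (n : ℕ) : ∃ c : ℕ → ℕ → ℚ, ∀ t : ℚ,
    (∀ i ∈ range (n + 1), t + i ≠ 0) → As s δ n t = pfEval (range (n + 1)) (fun _ => 2 * s + 4) c t := by
  classical
  set P : ℚ[X] := C ((2 : ℚ) ^ ((6 * s + 12) * n)) * (C 4 * X + C (2 * (n : ℚ))) ^ δ *
    ((∏ j ∈ range n, (X + C ((1 : ℚ) / 4 + j))) ^ (s + 2) * (∏ j ∈ range n, (X + C ((3 : ℚ) / 4 + j))) ^ (s + 2))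
    with hP
  have hlin : (C (4 : ℚ) * X + C (2 * (n : ℚ))).natDegree ≤ 1 := by
    refine (natDegree_add_le _ _).trans (max_le ?_ ((natDegree_C _).trans_le (Nat.zero_le _)))
    exact (natDegree_C_mul_le _ _).trans natDegree_X_le
  have hdegP : P.natDegree ≤ δ + (2 * s + 4) * n := by
    have h1 := (natDegree_pow_le (p := ∏ j ∈ range n, (X + C ((1 : ℚ) / 4 + j))) (n := s + 2)).trans
      (Nat.mul_le_mul_left (s + 2) (natDegree_prod_X_add_C_le'' n fun j => (1 : ℚ) / 4 + j))
    have h3 := (natDegree_pow_le (p := ∏ j ∈ range n, (X + C ((3 : ℚ) / 4 + j))) (n := s + 2)).trans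
      (Nat.mul_le_mul_left (s + 2) (natDegree_prod_X_add_C_le'' n fun j => (3 : ℚ) / 4 + j))
    have hδ' := (natDegree_pow_le (p := C (4 : ℚ) * X + C (2 * (n : ℚ))) (n := δ)).trans
      (Nat.mul_le_mul_left δ hlin)
    rw [hP]
    refine (natDegree_mul_le).trans ?_
    refine (add_le_add ((natDegree_mul_le).trans (add_le_add (natDegree_C _).le hδ'))
      ((natDegree_mul_le).trans (add_le_add h1 h3))).trans ?_
    ring_nf; omega
  have hdeg : P.natDegree < (powShifts n (2 * s + 4)).length := by
    rw [length_powShifts']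
    have : (2 * s + 4) * n + δ < (2 * s + 4) * (n + 1) := by nlinarith
    omega
  obtain ⟨c, hc⟩ := exists_pfEval_eq_eval_mul_prod_inv (range (n + 1)) P (powShifts n (2 * s + 4))
    (fun i hi => mem_range_of_mem_powShifts' hi) hdeg
  have hPeval : ∀ t : ℚ, P.eval t = 2 ^ ((6 * s + 12) * n) * (4 * t + 2 * n) ^ δ *
      ((∏ j ∈ range n, (t + 1 / 4 + j)) ^ (s + 2) * (∏ j ∈ range n, (t + 3 / 4 + j)) ^ (s + 2)) := by
    intro t
    have e1 : ∏ j ∈ range n, (t + (1 / 4 + (j : ℚ))) = ∏ j ∈ range n, (t + 1 / 4 + j) :=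
      prod_congr rfl fun j _ => by ring
    have e3 : ∏ j ∈ range n, (t + (3 / 4 + (j : ℚ))) = ∏ j ∈ range n, (t + 3 / 4 + j) :=
      prod_congr rfl fun j _ => by ring
    rw [hP]
    simp only [eval_mul, eval_C, eval_pow, eval_prod, eval_add, eval_X]
    rw [e1, e3]
  have hA : ∀ t : ℚ, As s δ n t = P.eval t * ((powShifts n (2 * s + 4)).map fun i : ℕ => (t + (i : ℚ))⁻¹).prod := by
    intro t
    rw [prod_powShifts', hPeval, As, div_eq_mul_inv]
  have hPF : IsPF (range (n + 1)) (fun i => (powShifts n (2 * s + 4)).count i) (As s δ n) :=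
    ⟨c, fun t ht => (hA t).trans (hc t ht)⟩
  obtain ⟨c', hc'⟩ := hPF.mono fun i _ => count_powShifts_le' n (2 * s + 4) i
  exact ⟨c', hc'⟩

/-- For ANY expansion `A_n = Σ_{k ≤ n} Σ_{r ≤ 2s+4} c_{k,r}(t+k)^{−r}` off the poles, `c_{k,i} = a_{n,i,k}`
(`k ≤ n`, `1 ≤ i ≤ 2s+4`): the coefficients are the Taylor coefficients of `(t+k)^{2s+4}A_n(t)` at `−k`.
[cite: Lai2025TwoAdicZeta, Definition 3.1 (def_a) and Lemma 4.2 (proof)] -/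
theorem coeffAs_eq_of_pfEval (s δ n : ℕ) {c : ℕ → ℕ → ℚ}
    (hc : ∀ t : ℚ, (∀ i ∈ range (n + 1), t + i ≠ 0) → As s δ n t = pfEval (range (n + 1)) (fun _ => 2 * s + 4) c t)
    {k : ℕ} (hk : k ≤ n) {i : ℕ} (hi1 : 1 ≤ i) (hi2 : i ≤ 2 * s + 4) : coeffAs s δ n i k = c k i := by
  have hk' : k ∈ range (n + 1) := mem_range.2 (by omega)
  have h := divDeriv_eq_coeff_of_pfEval (T := range (n + 1)) (A := 2 * s + 4) (f := As s δ n) (g := AsReg s δ n k)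
    (q := fun _ => 0) (c := c) hk' contDiffAt_const (fun t ht => by rw [hc t ht, zero_add])
    (contDiffAt_AsReg_neg s δ n k (N := 0)).continuousAt
    (fun t ht => AsReg_eq s δ n k ht (ht k hk')) (a := 2 * s + 4 - i) (by omega)
  rw [coeffAs, h, show 2 * s + 4 - (2 * s + 4 - i) = i by omega]

/-- **(def_a), general `s`** (`δ ≤ 1`): off the poles, `A_n(t) = Σ_{k=0}^{n} Σ_{i=1}^{2s+4} a_{n,i,k} (t+k)^{−i}`.
[cite: Lai2025TwoAdicZeta, Definition 3.1 (the partial-fraction decomposition (def_a) of A_n)] -/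
theorem As_eq_sum_coeffAs (s : ℕ) {δ : ℕ} (hδ : δ ≤ 1) (n : ℕ) {t : ℚ} (ht : ∀ j ∈ range (n + 1), t + j ≠ 0) :
    As s δ n t = ∑ k ∈ range (n + 1), ∑ i ∈ Icc 1 (2 * s + 4), coeffAs s δ n i k * ((t + k) ^ i)⁻¹ := by
  obtain ⟨c, hc⟩ := exists_As_eq_pfEval s hδ n
  rw [hc t ht, pfEval]
  refine sum_congr rfl fun k hk => sum_congr rfl fun i hi => ?_
  have hi' := mem_Icc.1 hi
  rw [coeffAs_eq_of_pfEval s δ n hc (by have := mem_range.1 hk; omega) hi'.1 hi'.2]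

/-- `a_{n,2s+4,k} = Q_k(−k)^{s+2}(2n−4k)^δ` (the value of the brick form at `−k`).
[cite: Lai2025TwoAdicZeta, Lemma 4.2 (proof: a_{n,i,k} as a Taylor coefficient, i = 2s+4)] -/
theorem coeffAs_top_eq (s δ n k : ℕ) :
    coeffAs s δ n (2 * s + 4) k = Qk n k (-(k : ℚ)) ^ (s + 2) * (4 * (-(k : ℚ)) + 2 * n) ^ δ := by
  rw [coeffAs, Nat.sub_self, divDeriv_zero, AsReg]

/-! ## §3. The coefficient estimate of Lemma 5.2 for `a_{n,i,k}` (general `s`)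

DEVIATION (flagged): the source bounds `a_{n,i,k}` by Cauchy's integral formula on the circle `|t+k| = ⅛`.  Here, as in
the sibling file, the Taylor coefficients of the bricks are bounded termwise (`TaylorBound`). -/

/-- `|∏_{j<n}(−k + ¼ + j)| ≤ k!(n−k)!` (`k ≤ n`): `|j − k + ¼| ≤ k − j` for `j < k` and `≤ j − k + 1` for `j ≥ k`.
[cite: Lai2025TwoAdicZeta, Lemma 5.2 (proof)] -/
theorem abs_prod_quarter_one_le (n : ℕ) {k : ℕ} (hk : k ≤ n) :
    |∏ j ∈ range n, (-(k : ℚ) + ((((1 : ℤ) : ℚ)) / 4 + j))| ≤ (k ! : ℚ) * ((n - k)! : ℚ) := by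
  rw [abs_prod, ← prod_range_mul_prod_Ico _ hk]
  have h1 : ∏ j ∈ range k, |(-(k : ℚ) + ((((1 : ℤ) : ℚ)) / 4 + j))| ≤ (k ! : ℚ) := by
    have hle : ∏ j ∈ range k, |(-(k : ℚ) + ((((1 : ℤ) : ℚ)) / 4 + j))| ≤ ∏ j ∈ range k, ((k : ℚ) - j) := by
      refine prod_le_prod (fun j _ => abs_nonneg _) fun j hj => ?_
      have hj' : (j : ℚ) + 1 ≤ k := by exact_mod_cast (mem_range.1 hj)
      rw [abs_le]; constructor <;> push_cast <;> linarith
    refine hle.trans (le_of_eq ?_)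
    rw [← prod_range_reflect, ← prod_range_add_one_eq_factorial, Nat.cast_prod]
    refine prod_congr rfl fun j hj => ?_
    have hj' := mem_range.1 hj
    rw [Nat.cast_sub (by omega : j ≤ k - 1), Nat.cast_sub (by omega : 1 ≤ k)]; push_cast; ring
  have h2 : ∏ j ∈ Ico k n, |(-(k : ℚ) + ((((1 : ℤ) : ℚ)) / 4 + j))| ≤ ((n - k)! : ℚ) := by
    have hle : ∏ j ∈ Ico k n, |(-(k : ℚ) + ((((1 : ℤ) : ℚ)) / 4 + j))| ≤ ∏ j ∈ Ico k n, ((j : ℚ) - k + 1) := by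
      refine prod_le_prod (fun j _ => abs_nonneg _) fun j hj => ?_
      have hj' : (k : ℚ) ≤ j := by exact_mod_cast (mem_Ico.1 hj).1
      rw [abs_le]; constructor <;> push_cast <;> linarith
    refine hle.trans (le_of_eq ?_)
    rw [prod_Ico_eq_prod_range, ← prod_range_add_one_eq_factorial, Nat.cast_prod]
    refine prod_congr rfl fun j _ => ?_
    push_cast; ring
  have h20 : 0 ≤ ∏ j ∈ Ico k n, |(-(k : ℚ) + ((((1 : ℤ) : ℚ)) / 4 + j))| := prod_nonneg fun _ _ => abs_nonneg _
  exact mul_le_mul h1 h2 h20 (by positivity)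

/-- `|F_{1/4}(−k)·((t+k)G)(−k)| ≤ 2^{3n}` (`k ≤ n`): `|F_{1/4}(−k)| ≤ 2^{3n}k!(n−k)!/n!`, `|((t+k)G)(−k)| = n!/(k!(n−k)!)`.
[cite: Lai2025TwoAdicZeta, Lemma 5.2 (proof)] -/
theorem abs_quarterBrick_one_mul_Greg_le (n : ℕ) {k : ℕ} (hk : k ≤ n) :
    |quarterBrick 1 n (-(k : ℚ)) * Greg n k (-(k : ℚ))| ≤ (2 : ℚ) ^ (3 * n) := by
  have hf : (0 : ℚ) < n ! := by exact_mod_cast Nat.factorial_pos n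
  have hk1 : (0 : ℚ) < k ! := by exact_mod_cast Nat.factorial_pos k
  have hk2 : (0 : ℚ) < (n - k)! := by exact_mod_cast Nat.factorial_pos (n - k)
  have hG : |Greg n k (-(k : ℚ))| = (n ! : ℚ) / ((k ! : ℚ) * ((n - k)! : ℚ)) := by
    rw [Greg_neg n hk, abs_div, abs_mul, abs_pow, abs_neg, abs_one, one_pow, one_mul, abs_of_pos hf,
      abs_of_pos (by positivity)]
  have hF : |quarterBrick 1 n (-(k : ℚ))| ≤ (2 : ℚ) ^ (3 * n) * ((k ! : ℚ) * ((n - k)! : ℚ)) / (n ! : ℚ) := by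
    rw [quarterBrick, abs_mul, abs_div, abs_of_pos hf, abs_of_pos (by positivity : (0 : ℚ) < 2 ^ (3 * n)),
      div_mul_eq_mul_div]
    exact div_le_div_of_nonneg_right (mul_le_mul_of_nonneg_left (abs_prod_quarter_one_le n hk) (by positivity)) hf.le
  rw [abs_mul, hG]
  calc |quarterBrick 1 n (-(k : ℚ))| * ((n ! : ℚ) / ((k ! : ℚ) * ((n - k)! : ℚ)))
      ≤ (2 : ℚ) ^ (3 * n) * ((k ! : ℚ) * ((n - k)! : ℚ)) / (n ! : ℚ) * ((n ! : ℚ) / ((k ! : ℚ) * ((n - k)! : ℚ))) :=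
        mul_le_mul_of_nonneg_right hF (by positivity)
    _ = (2 : ℚ) ^ (3 * n) := by field_simp

/-- `|Q_k(−k)| ≤ 2^{6n}` (`k ≤ n`). [cite: Lai2025TwoAdicZeta, Lemma 5.2 (proof: max|a_{n,i,k}| ≤ 2^{(6s+12+o(1))n})] -/
theorem abs_Qk_neg_le (n : ℕ) {k : ℕ} (hk : k ≤ n) : |Qk n k (-(k : ℚ))| ≤ (2 : ℚ) ^ (6 * n) := by
  rw [Qk, show quarterBrick 1 n (-(k : ℚ)) * Pk n k (-(k : ℚ)) * Greg n k (-(k : ℚ)) =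
    (quarterBrick 1 n (-(k : ℚ)) * Greg n k (-(k : ℚ))) * Pk n k (-(k : ℚ)) by ring, abs_mul,
    show (2 : ℚ) ^ (6 * n) = 2 ^ (3 * n) * 2 ^ (3 * n) by rw [← pow_add]; ring_nf]
  exact mul_le_mul (abs_quarterBrick_one_mul_Greg_le n hk) (abs_Pk_neg_le n hk) (abs_nonneg _) (by positivity)

/-- The RATE `c_Q(n,k) := Σ_{j<n}|j − k + ¼|^{−1} + c_P(n,k) + Σ_{l ≤ n, l ≠ k}|l − k|^{−1}` of the brick product `Q_k`
at `−k`. [cite: Lai2025TwoAdicZeta, Lemma 5.2 (proof)] -/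
def cQ (n k : ℕ) : ℚ :=
  ∑ j ∈ range n, |(-(k : ℚ)) + ((((1 : ℤ) : ℚ)) / 4 + j)|⁻¹ + cP n k +
    ∑ l ∈ (range (n + 1)).filter (fun l => l ≠ k), |(-(k : ℚ)) + l|⁻¹

/-- `c_Q(n,k) ≥ 0`. [cite: Lai2025TwoAdicZeta, Lemma 5.2 (proof)] -/
theorem cQ_nonneg (n k : ℕ) : 0 ≤ cQ n k :=
  add_nonneg (add_nonneg (sum_nonneg fun _ _ => inv_nonneg.2 (abs_nonneg _)) (cP_nonneg n k))
    (sum_nonneg fun _ _ => inv_nonneg.2 (abs_nonneg _))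

/-- **`c_Q(n,k) ≤ 10n`**: the `n` new quarter factors have `|j − k + ¼| ≥ ¼`, `c_P ≤ 5n`, the `n` integer factors
`|l − k| ≥ 1`. [cite: Lai2025TwoAdicZeta, Lemma 5.2 (proof)] -/
theorem cQ_le (n : ℕ) {k : ℕ} (hk : k ≤ n) : cQ n k ≤ 10 * n := by
  have h1 : ∑ j ∈ range n, |(-(k : ℚ)) + ((((1 : ℤ) : ℚ)) / 4 + j)|⁻¹ ≤ ∑ _j ∈ range n, (4 : ℚ) := by
    refine sum_le_sum fun j _ => ?_
    have hq : (1 / 4 : ℚ) ≤ |(-(k : ℚ)) + ((((1 : ℤ) : ℚ)) / 4 + j)| := by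
      rcases Nat.lt_or_ge j k with hkj | hkj
      · have : (j : ℚ) + 1 ≤ k := by exact_mod_cast hkj
        rw [abs_of_neg (by push_cast; linarith)]; push_cast; linarith
      · have : (k : ℚ) ≤ j := by exact_mod_cast hkj
        rw [abs_of_nonneg (by push_cast; linarith)]; push_cast; linarith
    calc |(-(k : ℚ)) + ((((1 : ℤ) : ℚ)) / 4 + j)|⁻¹ ≤ (1 / 4 : ℚ)⁻¹ := inv_anti₀ (by norm_num) hq
      _ = 4 := by norm_num
  have h2 : ∑ l ∈ (range (n + 1)).filter (fun l => l ≠ k), |(-(k : ℚ)) + l|⁻¹ ≤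
      ∑ _l ∈ (range (n + 1)).filter (fun l => l ≠ k), (1 : ℚ) := by
    refine sum_le_sum fun l hl => ?_
    have hlk : l ≠ k := (mem_filter.1 hl).2
    have hq : (1 : ℚ) ≤ |(-(k : ℚ)) + l| := by
      rw [show (-(k : ℚ) + l) = (((l : ℤ) - k : ℤ) : ℚ) by push_cast; ring, ← Int.cast_abs]
      have : (1 : ℤ) ≤ |(l : ℤ) - k| := Int.one_le_abs (sub_ne_zero.2 (by exact_mod_cast hlk))
      exact_mod_cast this
    calc |(-(k : ℚ)) + l|⁻¹ ≤ (1 : ℚ)⁻¹ := inv_anti₀ (by norm_num) hq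
      _ = 1 := inv_one
  have hcard : ((range (n + 1)).filter (fun l => l ≠ k)).card = n := by
    rw [filter_ne', card_erase_of_mem (mem_range.2 (by omega)), card_range]; rfl
  have h3 := cP_le n hk
  rw [cQ]
  refine (add_le_add (add_le_add h1 h3) h2).trans ?_
  rw [sum_const, sum_const, card_range, hcard, nsmul_eq_mul, nsmul_eq_mul]
  ring_nf
  nlinarith

/-- `−k + (¼ + j) ≠ 0`. [folklore] -/
private theorem neg_add_quarter_one_ne_zero (k j : ℕ) : (-(k : ℚ) + ((((1 : ℤ) : ℚ)) / 4 + j)) ≠ 0 := by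
  intro h
  have h4 : (4 : ℚ) * (-(k : ℚ) + ((((1 : ℤ) : ℚ)) / 4 + j)) = ((4 * (j : ℤ) - 4 * k + 1 : ℤ) : ℚ) := by
    push_cast; ring
  rw [h, mul_zero] at h4
  have : (4 * (j : ℤ) - 4 * k + 1 : ℤ) = 0 := by exact_mod_cast h4.symm
  omega

/-- **The geometric data of `Q_k` at `−k`** (`k ≤ n`): `|𝒟_m Q_k(−k)| ≤ |Q_k(−k)|·c_Q(n,k)^m` for all `m`
(`Q_k = F_{1/4}·P_k·((t+k)G)`: the sibling's data for `P_k`, the `n` linear bricks of `F_{1/4}` and the `n` inverse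
linear bricks of `(t+k)G`). [cite: Lai2025TwoAdicZeta, Lemma 5.2 (proof)] -/
theorem taylorBound_Qk (n : ℕ) {k : ℕ} (hk : k ≤ n) (N : ℕ) :
    TaylorBound N (Qk n k) (-(k : ℚ)) |Qk n k (-(k : ℚ))| (cQ n k) := by
  classical
  set x : ℚ := -(k : ℚ) with hx
  have hA := TaylorBound.const N x ((2 : ℚ) ^ (3 * n) / (n ! : ℚ))
  have hquart : ∀ j ∈ range n, x + ((((1 : ℤ) : ℚ)) / 4 + j) ≠ 0 := fun j _ => by
    rw [hx]; exact neg_add_quarter_one_ne_zero k j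
  have hB := TaylorBound.finset_prod (N := N) (x := x) (range n)
    (F := fun j t => t + ((((1 : ℤ) : ℚ)) / 4 + j)) (fun j hj => TaylorBound.linear N _ (hquart j hj))
  have hF : TaylorBound N (quarterBrick 1 n) x _ _ := (hA.mul hB).congr (Eventually.of_forall fun t => by
    show (2 : ℚ) ^ (3 * n) / (n ! : ℚ) * (∏ j ∈ range n, (t + ((((1 : ℤ) : ℚ)) / 4 + j))) = quarterBrick 1 n t
    rw [quarterBrick])
  have hP := taylorBound_Pk n hk N
  have hC := TaylorBound.const N x (n ! : ℚ)
  have hint : ∀ l ∈ (range (n + 1)).filter (fun l => l ≠ k), x + (l : ℚ) ≠ 0 := fun l hl => by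
    rw [hx]; exact neg_add_ne_zero_of_ne'' (mem_filter.1 hl).2
  have hD := TaylorBound.finset_prod (N := N) (x := x) ((range (n + 1)).filter (fun l => l ≠ k))
    (F := fun l t => (t + (l : ℚ))⁻¹) (fun l hl => TaylorBound.invLinear N _ (hint l hl))
  have hG : TaylorBound N (Greg n k) x _ _ := (hC.mul hD).congr (Eventually.of_forall fun t => by
    show (n ! : ℚ) * ∏ l ∈ (range (n + 1)).filter (fun l => l ≠ k), (t + (l : ℚ))⁻¹ = Greg n k t
    rw [Greg_eq n hk t])
  have hQ := (hF.mul hP).mul hG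
  have hQ' : TaylorBound N (Qk n k) x _ _ := hQ.congr (Eventually.of_forall fun t => by rw [Qk])
  -- the constants: `M = |Q_k(−k)|`, `c = c_Q`
  have hM : |(2 : ℚ) ^ (3 * n) / (n ! : ℚ)| * (∏ j ∈ range n, |x + ((((1 : ℤ) : ℚ)) / 4 + j)|) * |Pk n k x| *
      (|(n ! : ℚ)| * ∏ l ∈ (range (n + 1)).filter (fun l => l ≠ k), |x + (l : ℚ)|⁻¹) = |Qk n k x| := by
    rw [Qk, quarterBrick, Greg_eq n hk x, abs_mul, abs_mul, abs_mul, abs_mul, abs_prod, abs_prod]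
    congr 2
    exact prod_congr rfl fun l _ => (abs_inv _).symm
  have hc : (0 : ℚ) + ∑ j ∈ range n, |x + ((((1 : ℤ) : ℚ)) / 4 + j)|⁻¹ + cP n k +
      (0 + ∑ l ∈ (range (n + 1)).filter (fun l => l ≠ k), |x + (l : ℚ)|⁻¹) = cQ n k := by
    rw [cQ, hx]; ring
  exact hQ'.mono (le_of_eq hM) (le_of_eq hc)

/-- The linear factor `4t + 2n` at `−k` (`k ≤ n`): `|𝒟_0| = |2n − 4k| ≤ 4n+4`, `𝒟_1 = 4`, `𝒟_m = 0` (`m ≥ 2`), so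
`TaylorBound` with `M = 4n+4`, `c = 1`. [cite: Lai2025TwoAdicZeta, Lemma 5.2 (proof: the factor (4t+2n)^δ of A_n)] -/
theorem taylorBound_linearFactor (n : ℕ) {k : ℕ} (hk : k ≤ n) (N : ℕ) :
    TaylorBound N (fun t : ℚ => 4 * t + 2 * n) (-(k : ℚ)) (4 * n + 4) 1 := by
  refine ⟨by fun_prop, by positivity, zero_le_one, fun m _ => ?_⟩
  have key : iteratedDeriv m (fun t : ℚ => 4 * t + 2 * n) (-(k : ℚ)) =
      if m = 0 then 4 * (-(k : ℚ)) + 2 * n else if m = 1 then 4 else 0 :=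
    iteratedDeriv_affine 4 (2 * n) (-(k : ℚ)) m
  have hkn : (k : ℚ) ≤ n := by exact_mod_cast hk
  have hk0 : (0 : ℚ) ≤ k := Nat.cast_nonneg k
  rw [divDeriv, key, one_pow, mul_one]
  rcases m with _ | _ | m
  · rw [if_pos rfl, Nat.factorial_zero, Nat.cast_one, div_one, abs_le]
    constructor <;> linarith
  · rw [if_neg (by omega), if_pos rfl, Nat.factorial_one, Nat.cast_one, div_one,
      abs_of_pos (by norm_num : (0 : ℚ) < 4)]
    linarith
  · rw [if_neg (by omega), if_neg (by omega), zero_div, abs_zero]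
    positivity

/-- **The geometric data of `(t+k)^{2s+4}A_n(t)` at `−k`**:
`|𝒟_m(Q_k^{s+2}(4t+2n)^δ)(−k)| ≤ 2^{(6s+12)n}(4n+4)^δ·((s+2)c_Q + δ)^m`. [cite: Lai2025TwoAdicZeta, Lemma 5.2 (proof)] -/
theorem taylorBound_AsReg (s δ n : ℕ) {k : ℕ} (hk : k ≤ n) (N : ℕ) :
    TaylorBound N (AsReg s δ n k) (-(k : ℚ)) ((2 : ℚ) ^ ((6 * s + 12) * n) * (4 * n + 4) ^ δ)
      ((s + 2 : ℕ) * cQ n k + δ) := by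
  have hQ := ((taylorBound_Qk n hk N).pow (s + 2)).mono
    (M' := (2 : ℚ) ^ ((6 * s + 12) * n)) (c' := ((s + 2 : ℕ) : ℚ) * cQ n k) ?_ le_rfl
  · have hL := (taylorBound_linearFactor n hk N).pow δ
    have h := hQ.mul hL
    refine (h.congr (Eventually.of_forall fun t => by rw [AsReg])).mono le_rfl (le_of_eq ?_)
    push_cast; ring
  · calc |Qk n k (-(k : ℚ))| ^ (s + 2) ≤ ((2 : ℚ) ^ (6 * n)) ^ (s + 2) :=
          pow_le_pow_left₀ (abs_nonneg _) (abs_Qk_neg_le n hk) _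
      _ = (2 : ℚ) ^ ((6 * s + 12) * n) := by rw [← pow_mul]; ring_nf

/-- **Lemma 5.2 for the coefficients of `A_n` (general `s`), explicit form:**
`|a_{n,i,k}| ≤ 2^{(6s+12)n}(4n+4)^δ·((s+2)c_Q(n,k) + δ)^{2s+4−i}` (`k ≤ n`).
[cite: Lai2025TwoAdicZeta, Lemma 5.2 (proof: "It suffices to show max_{i,k}|a_{n,i,k}| ≤ 2^{(6s+12+o(1))n}")] -/
theorem abs_coeffAs_le_cQ (s δ n : ℕ) {k : ℕ} (hk : k ≤ n) (i : ℕ) :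
    |coeffAs s δ n i k| ≤ (2 : ℚ) ^ ((6 * s + 12) * n) * (4 * n + 4) ^ δ *
      (((s + 2 : ℕ) : ℚ) * cQ n k + δ) ^ (2 * s + 4 - i) := by
  rw [coeffAs]
  exact (taylorBound_AsReg s δ n hk (2 * s + 4 - i)).bound (2 * s + 4 - i) le_rfl

/-- **Lemma 5.2 for the coefficients of `A_n` (general `s`):** `|a_{n,i,k}| ≤ 2^{(6s+12)n}(4n+4)^δ(10(s+2)n + δ)^{2s+4−i}`
(`k ≤ n`) — the printed `max_{i,k}|a_{n,i,k}| ≤ 2^{(6s+12+o(1))n}` with an explicit polynomial factor.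
[cite: Lai2025TwoAdicZeta, Lemma 5.2 (rho_est), proof] -/
theorem abs_coeffAs_le (s δ n : ℕ) {k : ℕ} (hk : k ≤ n) (i : ℕ) :
    |coeffAs s δ n i k| ≤ (2 : ℚ) ^ ((6 * s + 12) * n) * (4 * n + 4) ^ δ *
      (10 * ((s + 2 : ℕ) : ℚ) * n + δ) ^ (2 * s + 4 - i) := by
  refine (abs_coeffAs_le_cQ s δ n hk i).trans (mul_le_mul_of_nonneg_left ?_ (by positivity))
  refine pow_le_pow_left₀ (add_nonneg (mul_nonneg (by positivity) (cQ_nonneg n k)) (by positivity)) ?_ _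
  have := cQ_le n hk
  nlinarith [cQ_nonneg n k, (by positivity : (0 : ℚ) ≤ ((s + 2 : ℕ) : ℚ))]

/-! ## §4. The symmetry `A_n(−t−n) = (−1)^δ A_n(t)` and the parity of the coefficients -/

/-- **The symmetry of `A_n`**: `A_n(−t−n) = (−1)^δ A_n(t)` («which implies `(−1)^i a_{n,i,n−k} = (−1)^δ a_{n,i,k}` for all
`i, k`»): under `t ↦ −t−n` the factors `(t+¼)_n` and `(t+¾)_n` are exchanged up to the sign `(−1)^n` each,
`(t)_{n+1}` picks up `(−1)^{n+1}` and `4t+2n` changes sign. [cite: Lai2025TwoAdicZeta, Lemma 3.3 (proof: "The rational function A_n(t) has the symmetry A_n(−t−n) = (−1)^δ A_n(t)")] -/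
theorem As_reflect (s δ n : ℕ) (t : ℚ) : As s δ n (-t - n) = (-1) ^ δ * As s δ n t := by
  have h1 : ∏ j ∈ range n, (-t - n + 1 / 4 + (j : ℚ)) = (-1) ^ n * ∏ j ∈ range n, (t + 3 / 4 + (j : ℚ)) := by
    rw [← prod_range_reflect (fun j => t + 3 / 4 + (j : ℚ)) n,
      show ((-1 : ℚ)) ^ n = ∏ _j ∈ range n, (-1 : ℚ) by rw [prod_const, card_range], ← prod_mul_distrib]
    refine prod_congr rfl fun j hj => ?_
    have hj := mem_range.1 hj
    rw [Nat.cast_sub (by omega : j ≤ n - 1), Nat.cast_sub (by omega : 1 ≤ n)]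
    push_cast; ring
  have h3 : ∏ j ∈ range n, (-t - n + 3 / 4 + (j : ℚ)) = (-1) ^ n * ∏ j ∈ range n, (t + 1 / 4 + (j : ℚ)) := by
    rw [← prod_range_reflect (fun j => t + 1 / 4 + (j : ℚ)) n,
      show ((-1 : ℚ)) ^ n = ∏ _j ∈ range n, (-1 : ℚ) by rw [prod_const, card_range], ← prod_mul_distrib]
    refine prod_congr rfl fun j hj => ?_
    have hj := mem_range.1 hj
    rw [Nat.cast_sub (by omega : j ≤ n - 1), Nat.cast_sub (by omega : 1 ≤ n)]
    push_cast; ring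
  have h0 : ∏ j ∈ range (n + 1), (-t - n + (j : ℚ)) = (-1) ^ (n + 1) * ∏ j ∈ range (n + 1), (t + (j : ℚ)) := by
    rw [← prod_range_reflect (fun j => t + (j : ℚ)) (n + 1),
      show ((-1 : ℚ)) ^ (n + 1) = ∏ _j ∈ range (n + 1), (-1 : ℚ) by rw [prod_const, card_range],
      ← prod_mul_distrib]
    refine prod_congr rfl fun j hj => ?_
    have hj := mem_range.1 hj
    simp only [Nat.add_sub_cancel]
    rw [Nat.cast_sub (by omega : j ≤ n)]
    ring
  have hlin : (4 * (-t - n) + 2 * (n : ℚ)) = -(4 * t + 2 * n) := by ring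
  have e1 : ((-1 : ℚ) ^ n) ^ (s + 2) * ((-1 : ℚ) ^ n) ^ (s + 2) = 1 := by
    rw [← mul_pow, ← pow_add, ← two_mul, pow_mul, neg_one_sq, one_pow, one_pow]
  have e2 : ((-1 : ℚ) ^ (n + 1)) ^ (2 * s + 4) = 1 := by
    rw [← pow_mul, show (n + 1) * (2 * s + 4) = 2 * ((n + 1) * (s + 2)) by ring, pow_mul, neg_one_sq, one_pow]
  calc As s δ n (-t - n)
      = (2 : ℚ) ^ ((6 * s + 12) * n) * ((-1) ^ δ * (4 * t + 2 * n) ^ δ) *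
          ((((-1 : ℚ) ^ n) ^ (s + 2) * ((-1 : ℚ) ^ n) ^ (s + 2)) *
            ((∏ j ∈ range n, (t + 1 / 4 + (j : ℚ))) ^ (s + 2) * (∏ j ∈ range n, (t + 3 / 4 + (j : ℚ))) ^ (s + 2))) /
          (((-1 : ℚ) ^ (n + 1)) ^ (2 * s + 4) * (∏ j ∈ range (n + 1), (t + (j : ℚ))) ^ (2 * s + 4)) := by
        unfold As
        rw [hlin, h1, h3, h0, neg_pow (4 * t + 2 * (n : ℚ)) δ, mul_pow, mul_pow, mul_pow]
        ring
    _ = (-1) ^ δ * As s δ n t := by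
        rw [e1, e2, one_mul, one_mul]
        unfold As
        ring

/-- `t ↦ −t−n` preserves the set of poles `{0, −1, …, −n}`. [cite: Lai2025TwoAdicZeta, Lemma 3.3 (proof)] -/
private theorem reflect_ne_zero {n : ℕ} {t : ℚ} (ht : ∀ j ∈ range (n + 1), t + j ≠ 0) :
    ∀ j ∈ range (n + 1), -t - n + (j : ℚ) ≠ 0 := by
  intro j hj h
  have hj := mem_range.1 hj
  have := ht (n - j) (mem_range.2 (by omega))
  rw [Nat.cast_sub (by omega : j ≤ n)] at this
  exact this (by linarith)

/-- **The symmetry of the coefficients:** `a_{n,i,k} = (−1)^{i+δ} a_{n,i,n−k}` (`δ ≤ 1`, `k ≤ n`, `1 ≤ i ≤ 2s+4`) — the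
reflected expansion `A_n(t) = (−1)^δ A_n(−t−n) = ΣΣ (−1)^{i+δ}a_{n,i,n−k}(t+k)^{−i}` and the uniqueness of (def_a).
[cite: Lai2025TwoAdicZeta, Lemma 3.3 (proof: "(−1)^i a_{n,i,n−k} = (−1)^δ a_{n,i,k} for all i, k")] -/
theorem coeffAs_reflect (s : ℕ) {δ : ℕ} (hδ : δ ≤ 1) (n : ℕ) {k : ℕ} (hk : k ≤ n) {i : ℕ} (hi1 : 1 ≤ i)
    (hi2 : i ≤ 2 * s + 4) : coeffAs s δ n i k = (-1) ^ (i + δ) * coeffAs s δ n i (n - k) := by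
  have hsign : ((-1 : ℚ) ^ δ) * (-1) ^ δ = 1 := by
    rw [← pow_add, ← two_mul, pow_mul, neg_one_sq, one_pow]
  have hc : ∀ t : ℚ, (∀ j ∈ range (n + 1), t + j ≠ 0) → As s δ n t =
      pfEval (range (n + 1)) (fun _ => 2 * s + 4) (fun k i => (-1) ^ (i + δ) * coeffAs s δ n i (n - k)) t := by
    intro t ht
    have hA := As_eq_sum_coeffAs s hδ n (reflect_ne_zero ht)
    rw [As_reflect] at hA
    have hA' : As s δ n t = (-1) ^ δ * ∑ k ∈ range (n + 1), ∑ i ∈ Icc 1 (2 * s + 4),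
        coeffAs s δ n i k * ((-t - n + (k : ℚ)) ^ i)⁻¹ := by
      rw [← hA, ← mul_assoc, hsign, one_mul]
    rw [hA', pfEval, mul_sum, ← sum_range_reflect _ (n + 1)]
    refine sum_congr rfl fun k hk => ?_
    have hk' : k ≤ n := by have := mem_range.1 hk; omega
    rw [show n + 1 - 1 - k = n - k by omega, mul_sum]
    refine sum_congr rfl fun i _ => ?_
    have hinv : (((-1 : ℚ)) ^ i)⁻¹ = (-1) ^ i := by rw [← inv_pow, inv_neg, inv_one]
    rw [Nat.cast_sub hk', show (-t - (n : ℚ) + ((n : ℚ) - k)) = -(t + k) by ring, neg_pow (t + (k : ℚ)) i,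
      mul_inv, hinv, pow_add]
    ring
  exact coeffAs_eq_of_pfEval s δ n hc hk hi1 hi2

/-- **The parity vanishing** («So `ρ_{n,i} = 0` when `i > 0` and `i ≢ δ (mod 2)`»): for `i + δ` odd,
`Σ_{k=0}^{n} a_{n,i,k} = 0` (`δ ≤ 1`, `1 ≤ i ≤ 2s+4`). [cite: Lai2025TwoAdicZeta, Lemma 3.3 (proof)] -/
theorem sum_coeffAs_eq_zero_of_odd (s : ℕ) {δ : ℕ} (hδ : δ ≤ 1) (n : ℕ) {i : ℕ} (hi1 : 1 ≤ i)
    (hi2 : i ≤ 2 * s + 4) (hodd : Odd (i + δ)) : ∑ k ∈ range (n + 1), coeffAs s δ n i k = 0 := by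
  have hrefl : ∑ k ∈ range (n + 1), coeffAs s δ n i (n - k) = ∑ k ∈ range (n + 1), coeffAs s δ n i k := by
    have h := sum_range_reflect (fun k => coeffAs s δ n i k) (n + 1)
    simpa only [Nat.add_sub_cancel] using h
  have h : ∑ k ∈ range (n + 1), coeffAs s δ n i k = (-1) ^ (i + δ) * ∑ k ∈ range (n + 1), coeffAs s δ n i k := by
    calc ∑ k ∈ range (n + 1), coeffAs s δ n i k
        = ∑ k ∈ range (n + 1), (-1) ^ (i + δ) * coeffAs s δ n i (n - k) :=
          sum_congr rfl fun k hk => coeffAs_reflect s hδ n (by have := mem_range.1 hk; omega) hi1 hi2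
      _ = (-1) ^ (i + δ) * ∑ k ∈ range (n + 1), coeffAs s δ n i k := by rw [← mul_sum, hrefl]
  rw [hodd.neg_one_pow] at h
  linarith

/-! ## §5. `ρ_{n,1} = 0`: `Σ_k a_{n,1,k} = lim_{t→∞} tA_n(t) = 0` (deg `A_n ≤ −2` for `δ ≤ 1`) -/

/-- `0 ≤ A_n(N)` and `A_n(N) ≤ 2^{(6s+12)n}·6(n+1)/N³` for a natural number `N ≥ 1` and `δ ≤ 1` (each quarter factor
`≤ N+1+j`, `(t)_{n+1} = t·∏_{j<n}(t+1+j)`, `(4N+2n)^δ ≤ 6(n+1)N`, `N^{2s+4} ≥ N⁴`; in `ℝ`).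
[cite: Lai2025TwoAdicZeta, Definition 3.1 (deg A_n ≤ −2)] -/
theorem As_natCast_bounds (s : ℕ) {δ : ℕ} (hδ : δ ≤ 1) (n : ℕ) {N : ℕ} (hN : 1 ≤ N) :
    0 ≤ (As s δ n N : ℝ) ∧ (As s δ n N : ℝ) ≤ 2 ^ ((6 * s + 12) * n) * (6 * ((n : ℝ) + 1)) / (N : ℝ) ^ 3 := by
  have hN0 : (1 : ℝ) ≤ N := by exact_mod_cast hN
  have hn0 : (0 : ℝ) ≤ n := Nat.cast_nonneg n
  have hcast : (As s δ n N : ℝ) = 2 ^ ((6 * s + 12) * n) * (4 * (N : ℝ) + 2 * n) ^ δ *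
      ((∏ j ∈ range n, ((N : ℝ) + 1 / 4 + j)) ^ (s + 2) * (∏ j ∈ range n, ((N : ℝ) + 3 / 4 + j)) ^ (s + 2)) /
      (∏ j ∈ range (n + 1), ((N : ℝ) + j)) ^ (2 * s + 4) := by
    rw [As]; push_cast; ring
  have hA1 : 0 ≤ ∏ j ∈ range n, ((N : ℝ) + 1 / 4 + j) := prod_nonneg fun j _ => by positivity
  have hA3 : 0 ≤ ∏ j ∈ range n, ((N : ℝ) + 3 / 4 + j) := prod_nonneg fun j _ => by positivity
  have hB : ∏ j ∈ range (n + 1), ((N : ℝ) + j) = N * ∏ j ∈ range n, ((N : ℝ) + 1 + j) := by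
    rw [Finset.prod_range_succ']
    push_cast
    rw [add_zero, mul_comm]
    congr 1
    exact prod_congr rfl fun j _ => by ring
  set C : ℝ := ∏ j ∈ range n, ((N : ℝ) + 1 + j) with hC
  have hC0 : 0 < C := prod_pos fun j _ => by positivity
  have hA1C : ∏ j ∈ range n, ((N : ℝ) + 1 / 4 + j) ≤ C := prod_le_prod (fun j _ => by positivity) fun j _ => by linarith
  have hA3C : ∏ j ∈ range n, ((N : ℝ) + 3 / 4 + j) ≤ C := prod_le_prod (fun j _ => by positivity) fun j _ => by linarith
  have hlin : (4 * (N : ℝ) + 2 * n) ^ δ ≤ 6 * ((n : ℝ) + 1) * N := by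
    interval_cases δ
    · rw [pow_zero]; nlinarith
    · rw [pow_one]; nlinarith
  rw [hcast, hB]
  constructor
  · positivity
  · rw [mul_pow, div_le_div_iff₀ (by positivity) (by positivity)]
    have h1 : (∏ j ∈ range n, ((N : ℝ) + 1 / 4 + j)) ^ (s + 2) ≤ C ^ (s + 2) := pow_le_pow_left₀ hA1 hA1C _
    have h3 : (∏ j ∈ range n, ((N : ℝ) + 3 / 4 + j)) ^ (s + 2) ≤ C ^ (s + 2) := pow_le_pow_left₀ hA3 hA3C _
    have hN4 : (N : ℝ) ^ 4 ≤ (N : ℝ) ^ (2 * s + 4) := pow_le_pow_right₀ hN0 (by omega)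
    have hCC : C ^ (s + 2) * C ^ (s + 2) = C ^ (2 * s + 4) := by rw [← pow_add]; ring_nf
    calc 2 ^ ((6 * s + 12) * n) * (4 * (N : ℝ) + 2 * n) ^ δ *
          ((∏ j ∈ range n, ((N : ℝ) + 1 / 4 + j)) ^ (s + 2) * (∏ j ∈ range n, ((N : ℝ) + 3 / 4 + j)) ^ (s + 2)) *
          (N : ℝ) ^ 3
        ≤ 2 ^ ((6 * s + 12) * n) * (6 * ((n : ℝ) + 1) * N) * (C ^ (s + 2) * C ^ (s + 2)) * (N : ℝ) ^ 3 := by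
          gcongr
      _ = 2 ^ ((6 * s + 12) * n) * (6 * ((n : ℝ) + 1)) * ((N : ℝ) ^ 4 * C ^ (2 * s + 4)) := by rw [← hCC]; ring
      _ ≤ 2 ^ ((6 * s + 12) * n) * (6 * ((n : ℝ) + 1)) * ((N : ℝ) ^ (2 * s + 4) * C ^ (2 * s + 4)) := by
          gcongr

/-- `N·A_n(N) → 0` as `N → ∞` (`δ ≤ 1`; "`ρ_{n,1} = 0` since `deg A_n ≤ −2`"). [cite: Lai2025TwoAdicZeta, Lemma 3.3 (proof)] -/
private theorem tendsto_natCast_mul_As (s : ℕ) {δ : ℕ} (hδ : δ ≤ 1) (n : ℕ) :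
    Tendsto (fun N : ℕ => (N : ℝ) * (As s δ n N : ℝ)) atTop (𝓝 0) := by
  have hup : Tendsto (fun N : ℕ => (2 : ℝ) ^ ((6 * s + 12) * n) * (6 * ((n : ℝ) + 1)) / (N : ℝ)) atTop (𝓝 0) :=
    tendsto_const_div_atTop_nhds_zero_nat _
  refine squeeze_zero' ?_ ?_ hup
  · filter_upwards [eventually_ge_atTop 1] with N hN
    exact mul_nonneg (Nat.cast_nonneg N) (As_natCast_bounds s hδ n hN).1
  · filter_upwards [eventually_ge_atTop 1] with N hN
    have hN0 : (1 : ℝ) ≤ N := by exact_mod_cast hN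
    have h := (As_natCast_bounds s hδ n hN).2
    have hK : (0 : ℝ) ≤ 2 ^ ((6 * s + 12) * n) * (6 * ((n : ℝ) + 1)) := by positivity
    calc (N : ℝ) * (As s δ n N : ℝ) ≤ N * (2 ^ ((6 * s + 12) * n) * (6 * ((n : ℝ) + 1)) / (N : ℝ) ^ 3) :=
          mul_le_mul_of_nonneg_left h (by positivity)
      _ = 2 ^ ((6 * s + 12) * n) * (6 * ((n : ℝ) + 1)) / (N : ℝ) * (1 / N) := by field_simp
      _ ≤ 2 ^ ((6 * s + 12) * n) * (6 * ((n : ℝ) + 1)) / (N : ℝ) * 1 := by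
          refine mul_le_mul_of_nonneg_left ?_ (by positivity)
          rw [div_le_one (by positivity)]; exact hN0
      _ = _ := mul_one _

/-- **`ρ_{n,1} = 0`**, i.e. `Σ_{k=0}^{n} a_{n,1,k} = 0` for `δ ≤ 1` («`ρ_{n,1} = (−1)^s(s+1)!4^{s+1}·lim_{t→∞} tA_n(t) = 0`»
since `deg A_n ≤ −2`). [cite: Lai2025TwoAdicZeta, Lemma 3.3 (proof: ρ_{n,1} = 0)] -/
theorem sum_coeffAs_one_eq_zero (s : ℕ) {δ : ℕ} (hδ : δ ≤ 1) (n : ℕ) :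
    ∑ k ∈ range (n + 1), coeffAs s δ n 1 k = 0 := by
  set L : ℕ → ℕ → ℝ := fun i k => if i = 1 then (coeffAs s δ n 1 k : ℝ) else 0 with hL
  have hterm : ∀ k ∈ range (n + 1), ∀ i ∈ (Icc 1 (2 * s + 4) : Finset ℕ),
      Tendsto (fun N : ℕ => (N : ℝ) * ((coeffAs s δ n i k : ℝ) * (((N : ℝ) + k) ^ i)⁻¹)) atTop (𝓝 (L i k)) := by
    intro k _ i hi
    have h1 : Tendsto (fun N : ℕ => (N : ℝ) / ((N : ℝ) + k)) atTop (𝓝 1) := tendsto_natCast_div_add_atTop (k : ℝ)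
    by_cases hi' : i = 1
    · subst hi'
      simp only [hL, if_true, pow_one]
      have := h1.const_mul (coeffAs s δ n 1 k : ℝ)
      rw [mul_one] at this
      refine this.congr fun N => ?_
      ring
    · simp only [hL, if_neg hi']
      have hi2 : 2 ≤ i := by have := mem_Icc.1 hi; omega
      obtain ⟨r, rfl⟩ : ∃ r, i = r + 1 := ⟨i - 1, by omega⟩
      have h2 : Tendsto (fun N : ℕ => (((N : ℝ) + k) ^ r)⁻¹) atTop (𝓝 0) := by
        have ht : Tendsto (fun N : ℕ => ((N : ℝ) + k) ^ r) atTop atTop := by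
          refine (tendsto_pow_atTop (by omega)).comp ?_
          exact tendsto_atTop_add_const_right _ _ tendsto_natCast_atTop_atTop
        exact ht.inv_tendsto_atTop
      have h := (h1.mul h2).const_mul (coeffAs s δ n (r + 1) k : ℝ)
      rw [one_mul, mul_zero] at h
      refine h.congr' ?_
      filter_upwards [eventually_ge_atTop 1] with N hN
      have hNk : ((N : ℝ) + k) ≠ 0 := by positivity
      rw [pow_succ]
      field_simp
  have hsum : Tendsto (fun N : ℕ => (N : ℝ) * ∑ k ∈ range (n + 1), ∑ i ∈ (Icc 1 (2 * s + 4) : Finset ℕ),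
      (coeffAs s δ n i k : ℝ) * (((N : ℝ) + k) ^ i)⁻¹) atTop
      (𝓝 (∑ k ∈ range (n + 1), ∑ i ∈ (Icc 1 (2 * s + 4) : Finset ℕ), L i k)) := by
    have h := tendsto_finsetSum (range (n + 1)) fun k hk =>
      tendsto_finsetSum (Icc 1 (2 * s + 4) : Finset ℕ) fun i hi => hterm k hk i hi
    refine h.congr fun N => ?_
    rw [mul_sum]
    exact sum_congr rfl fun k _ => by rw [mul_sum]
  have hLsum : ∑ k ∈ range (n + 1), ∑ i ∈ (Icc 1 (2 * s + 4) : Finset ℕ), L i k =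
      ((∑ k ∈ range (n + 1), coeffAs s δ n 1 k : ℚ) : ℝ) := by
    push_cast
    refine sum_congr rfl fun k _ => ?_
    rw [sum_ite_eq' (Icc 1 (2 * s + 4) : Finset ℕ) 1 (fun _ => (coeffAs s δ n 1 k : ℝ)), if_pos (by simp)]
  have heq : ∀ᶠ N : ℕ in atTop, (N : ℝ) * (As s δ n N : ℝ) =
      (N : ℝ) * ∑ k ∈ range (n + 1), ∑ i ∈ (Icc 1 (2 * s + 4) : Finset ℕ),
        (coeffAs s δ n i k : ℝ) * (((N : ℝ) + k) ^ i)⁻¹ := by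
    filter_upwards [eventually_ge_atTop 1] with N hN
    have hne : ∀ j ∈ range (n + 1), (N : ℚ) + j ≠ 0 := fun j _ => by positivity
    rw [As_eq_sum_coeffAs s hδ n hne]
    push_cast
    rfl
  have hlim := (tendsto_natCast_mul_As s hδ n).congr' heq
  have huniq := tendsto_nhds_unique hlim hsum
  rw [hLsum] at huniq
  exact_mod_cast huniq.symm

end Literature.NumberTheory.Irrationality.Lai2025TwoAdic
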